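import Summits.Ventures.PackingBounds.SphericalCodes.DegreeFourEquality

/-!
# Equality at a quintic certificate with a repeated quadratic factor: the forced `s`-valency

Framing: lottery ticket; floor = certified bounds/negative ranges. Venture `PackingBounds`
(cell `pub-packcert`), spherical-code family; STRUCTURE lemma behind the `L₅ − 1` rows of the cell's
standard-angle grid — cells whose exact Delsarte value is Levenshtein's `L₅(n, s)`, an integer, realised
by `f(t) = (t - s)(t² + p t + q)²` with RATIONAL `p, q` but irrational (conjugate) interior nodes.

**Theorem.** Let `f = Σ_{k ≤ 5} f_k C_k^{μ}` (`f_k ≥ 0`, `f_0, f_1, f_2 > 0`) factor as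
`(t - s)(t² + pt + q)²`, and suppose `N · f_0 = f(1) = (1 - s)(1 + p + q)²`. If a code `C ⊂ S^{n-1}` with
pairwise inner products `≤ s` had `|C| = N`, then for every `x ∈ C`: each `u = ⟨x, y⟩` (`y ≠ x`) is `s`
or satisfies `u² = -pu - q` (roots of `f`), `Σ_y u = -1` (balanced, `DegreeThreeEquality`) and
`Σ_y u² = N/n - 1` (2-design, `DegreeFourEquality`); eliminating the two sums over the non-`s`
neighbours gives `m (s² + ps + q) = N/n - 1 - p + q(N - 1)` for the natural number
`m = #{y : ⟨x,y⟩ = s}`. Hence if no natural `m` satisfies this, `A(n, s) ≤ N - 1`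
(`degree_five_card_le_of_no_valency`). No irrational arithmetic is needed (the Galois-free route);
cf. Levenshtein 1992 (codes attaining `L_{2k-1}` carry the quadrature weights as distance
distribution) and Boyvalenkov–Landgev 1995.

## References
* V. I. Levenshtein, *Designs as maximum codes in polynomial metric spaces*, Acta Appl. Math. 29
  (1992) 1–82.
* P. Delsarte, J. M. Goethals, J. J. Seidel, Geom. Dedicata 6 (1977) 363–388, §4. [`DelsarteGoethalsSeidel1977`]
-/

noncomputable section

namespace Summit.Ventures.PackingBounds.SphericalCodes

open Finset Literature.Analysis.SpecialFunctions Literature.Geometry.DiscreteGeometry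
open scoped RealInnerProductSpace

/-- **No code attains a sharp quintic certificate `(t - s)(t² + pt + q)²` whose forced `s`-valency is
not a natural number.** With `f = Σ_{k ≤ 5} f_k C_k^{μ}` (`n = 2μ + 2`, `μ > 0`; `f_k ≥ 0`,
`f_0, f_1, f_2 > 0`) factoring as `(t - s)(t² + pt + q)²`, `N · f_0 = (1 - s)(1 + p + q)²` (`N ≥ 1`):
if no `m ∈ ℕ` satisfies `m (s² + ps + q) = N/n - 1 - p + q(N - 1)`, then every code `C ⊂ S^{n-1}` with
pairwise inner products `≤ s` has `|C| ≤ N - 1`. (LP equality case at Levenshtein's `L₅`: balanced +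
2-design per point + the root relation `u² = -pu - q`; Galois-free form.) -/
theorem degree_five_card_le_of_no_valency {n : ℕ} {μ : ℝ} (hnμ : (n : ℝ) = 2 * μ + 2) (hμ : 0 < μ)
    (s p q : ℝ) (f : ℕ → ℝ) (hf : ∀ k, 0 ≤ f k) (hf0 : 0 < f 0) (hf1 : 0 < f 1) (hf2 : 0 < f 2)
    (hfac : ∀ t : ℝ, ∑ k ∈ range (5 + 1), f k * gegenbauerSum μ k t = (t - s) * (t ^ 2 + p * t + q) ^ 2)
    (N : ℕ) (hN : 1 ≤ N) (hval : (N : ℝ) * f 0 = (1 - s) * (1 + p + q) ^ 2)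
    (hno : ∀ m : ℕ, (m : ℝ) * (s ^ 2 + p * s + q) ≠ (N : ℝ) / n - 1 - p + q * ((N : ℝ) - 1))
    (C : Finset (EuclideanSpace ℝ (Fin n)))
    (h1 : ∀ x ∈ C, ‖x‖ = 1) (h2 : ∀ x ∈ C, ∀ y ∈ C, x ≠ y → inner ℝ x y ≤ s) :
    C.card + 1 ≤ N := by
  classical
  have hF : ∀ t : ℝ, -1 ≤ t → t ≤ s → ∑ k ∈ range (5 + 1), f k * gegenbauerSum μ k t ≤ 0 := by
    intro t ht1 ht2
    rw [hfac]
    exact mul_nonpos_of_nonpos_of_nonneg (by linarith) (sq_nonneg _)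
  have hle := DelsarteLP.card_mul_le hnμ hμ 5 f hf s hF C h1 h2
  rw [hfac] at hle
  have hle' : (C.card : ℝ) * f 0 ≤ (N : ℝ) * f 0 := by rw [hval]; linarith
  have hcardle : (C.card : ℝ) ≤ N := le_of_mul_le_mul_right hle' hf0
  have hC : C.card ≤ N := by exact_mod_cast hcardle
  rcases hC.lt_or_eq with hlt | heqN
  · omega
  exfalso
  obtain ⟨x, hx⟩ := Finset.card_pos.1 (by omega : 0 < C.card)
  have heq' : (C.card : ℝ) * f 0 = ∑ k ∈ range (5 + 1), f k * gegenbauerSum μ k 1 := by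
    rw [hfac, heqN, hval]; ring
  -- roots: `u = s` or `u² + pu + q = 0`
  have hroots : ∀ y ∈ C.erase x, inner ℝ x y = s ∨ inner ℝ x y ^ 2 + p * inner ℝ x y + q = 0 := by
    intro y hy
    have hyC : y ∈ C := Finset.mem_of_mem_erase hy
    have hxy : x ≠ y := (Finset.ne_of_mem_erase hy).symm
    have h0 := DelsarteLP.sum_eq_zero_of_card_mul_eq hnμ hμ 5 f hf s hF C h1 h2 heq' hx hyC hxy
    rw [hfac] at h0
    rcases mul_eq_zero.1 h0 with h | h
    · left; linarith
    · right
      exact pow_eq_zero_iff (n := 2) (by norm_num) |>.1 h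
  -- balanced and 2-design identities at `x`
  have hbal : ∑ y ∈ C, inner ℝ x y = 0 :=
    sum_inner_eq_zero_of_card_mul_eq hnμ hμ 5 f hf s hF C h1 h2 heq' (by norm_num) hf1 x
  have hdes : ∑ y ∈ C, inner ℝ x y ^ 2 = (C.card : ℝ) / n :=
    sum_inner_sq_eq_of_card_mul_eq hnμ hμ 5 f hf s hF C h1 h2 heq' (by norm_num) hf2 hx
  have hxx : inner ℝ x x = 1 := by
    rw [real_inner_self_eq_norm_sq, h1 x hx, one_pow]
  rw [← Finset.add_sum_erase C _ hx, hxx] at hbal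
  rw [← Finset.add_sum_erase C _ hx, hxx, one_pow] at hdes
  -- split `C.erase x` into `P` (inner product `s`) and `Q` (the quadratic's roots)
  set P := (C.erase x).filter fun y => inner ℝ x y = s with hP
  set Q := (C.erase x).filter fun y => ¬ inner ℝ x y = s with hQ
  have hQroot : ∀ y ∈ Q, inner ℝ x y ^ 2 = -p * inner ℝ x y - q := by
    intro y hy
    have hy' := Finset.mem_filter.1 hy
    rcases hroots y hy'.1 with h | h
    · exact absurd h hy'.2
    · linarith
  have hcard : P.card + Q.card = (C.erase x).card := Finset.card_filter_add_card_filter_not _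
  have hcardC : (C.erase x).card + 1 = C.card := Finset.card_erase_add_one hx
  have hsum1 : ∑ y ∈ C.erase x, inner ℝ x y = (P.card : ℝ) * s + ∑ y ∈ Q, inner ℝ x y := by
    rw [← Finset.sum_filter_add_sum_filter_not (C.erase x) (fun y => inner ℝ x y = s), ← hP, ← hQ]
    congr 1
    rw [Finset.sum_congr rfl fun y hy => (Finset.mem_filter.1 hy).2, Finset.sum_const, nsmul_eq_mul]
  have hsum2 : ∑ y ∈ C.erase x, inner ℝ x y ^ 2 =
      (P.card : ℝ) * s ^ 2 + (-p * ∑ y ∈ Q, inner ℝ x y - q * (Q.card : ℝ)) := by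
    rw [← Finset.sum_filter_add_sum_filter_not (C.erase x) (fun y => inner ℝ x y = s), ← hP, ← hQ]
    congr 1
    · rw [Finset.sum_congr rfl fun y hy => by rw [(Finset.mem_filter.1 hy).2], Finset.sum_const,
        nsmul_eq_mul]
    · rw [Finset.sum_congr rfl fun y hy => hQroot y hy, Finset.sum_sub_distrib, Finset.sum_const,
        nsmul_eq_mul, ← Finset.mul_sum]
      ring
  rw [hsum1] at hbal
  rw [hsum2] at hdes
  have hQc : (Q.card : ℝ) = (N : ℝ) - 1 - P.card := by
    have : (P.card : ℝ) + Q.card + 1 = N := by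
      rw [← heqN]; exact_mod_cast (by omega : P.card + Q.card + 1 = C.card)
    linarith
  rw [heqN] at hdes
  -- eliminate `Σ_Q u` : from `hbal`, `Σ_Q u = -1 - |P| s`
  have hA : ∑ y ∈ Q, inner ℝ x y = -1 - (P.card : ℝ) * s := by linarith
  rw [hA, hQc] at hdes
  apply hno P.card
  linarith

end Summit.Ventures.PackingBounds.SphericalCodes

end
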